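import Literature.NumberTheory.LFunctions.HardyZFirstApprox
import HarnessLib

/-!
# The Dirichlet polynomial `A(½+it) = Σ_{k ≤ N} a_k k^{-(½+it)}` of the BCH mean square: phase form,
# conjugate, continuity, `|A|²` as a double sum

Topic `Literature/NumberTheory/LFunctions`. Everything in this file is PROVED (no named facts; the only
definition is the transparent `BCH.mollPoly`).

Bookkeeping shared by the diagonal (`BCHDiagonalMeanSquareMVT.lean`) and cross-term files of the
Balasubramanian–Conrey–Heath-Brown mean square (named fact
`Literature.Barriers.RiemannHypothesis.BalasubramanianConreyHeathBrown1985_meanSquare`): the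
Dirichlet polynomial is written, as in
`Literature.NumberTheory.LFunctions.LevinsonMS.norm_weighted_meanSquare_mul_sub_diag_le`, with the
exponent `-(((1/2 : ℝ) : ℂ) + t I)`:

* `BCH.mollPoly a N t = Σ_{k ≤ N} a_k k^{-(½+it)}`;
* `BCH.mollPoly_eq_sum_exp` — `= Σ a_k k^{-1/2} e^{-it log k}`; `BCH.conj_mollPoly`;
  `BCH.continuous_mollPoly`; `BCH.norm_mollPoly_le` (`≤ Σ |a_k| k^{-1/2}`);
* `BCH.normSq_mollPoly_eq` — `|A(½+it)|² = Σ_{h,k} a_h ā_k (hk)^{-1/2} e^{it(log k − log h)}`;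
* `BCH.sum_cpow_eq_mainSum` — the approximate functional equation sum in the same exponent
  convention is the tree's `TwistedMoment.mainSum`.

## References

* [Titchmarsh1986] E. C. Titchmarsh, *The Theory of the Riemann Zeta-Function*, 2nd ed. (1986), §7.4.
-/

noncomputable section

open Finset Real Complex
open scoped ComplexConjugate

namespace Literature.NumberTheory.LFunctions.BCH

open Literature.NumberTheory.LFunctions.TwistedMoment

/-- The Dirichlet polynomial `A(½+it) = Σ_{k ≤ N} a_k k^{-(½+it)}` in the exponent convention of
`LevinsonMS.norm_weighted_meanSquare_mul_sub_diag_le`. [cite: Titchmarsh1986, §7.4] -/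
def mollPoly (a : ℕ → ℂ) (N : ℕ) (t : ℝ) : ℂ :=
  ∑ k ∈ Finset.Icc 1 N, a k * (k : ℂ) ^ (-(((1 / 2 : ℝ) : ℂ) + t * I))

/-- Unfolding `mollPoly`. [folklore] -/
theorem mollPoly_def (a : ℕ → ℂ) (N : ℕ) (t : ℝ) :
    mollPoly a N t = ∑ k ∈ Finset.Icc 1 N, a k * (k : ℂ) ^ (-(((1 / 2 : ℝ) : ℂ) + t * I)) := rfl

/-- The exponent `-(½ + it)` in the two spellings. [folklore] -/
theorem neg_half_add_eq (t : ℝ) : -(((1 / 2 : ℝ) : ℂ) + t * I) = -(1 / 2 : ℂ) - t * I := by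
  push_cast
  ring

/-- `k^{-(½+it)} = k^{-1/2} e^{-it log k}` for `k ≥ 1`. [folklore] -/
theorem natCast_cpow_eq_exp {k : ℕ} (hk : 0 < k) (t : ℝ) :
    (k : ℂ) ^ (-(((1 / 2 : ℝ) : ℂ) + t * I)) =
      (((k : ℝ) ^ (-(1 / 2 : ℝ)) : ℝ) : ℂ) * cexp (-(I * t * Real.log k)) := by
  rw [neg_half_add_eq, natCast_cpow_neg_half_sub_eq hk]

/-- **Phase form**: `A(½+it) = Σ a_k k^{-1/2} e^{-it log k}`. [folklore] -/
theorem mollPoly_eq_sum_exp (a : ℕ → ℂ) (N : ℕ) (t : ℝ) :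
    mollPoly a N t =
      ∑ k ∈ Finset.Icc 1 N, a k * ((((k : ℝ) ^ (-(1 / 2 : ℝ)) : ℝ) : ℂ) * cexp (-(I * t * Real.log k))) :=
  Finset.sum_congr rfl fun k hk => by rw [natCast_cpow_eq_exp (Finset.mem_Icc.1 hk).1]

/-- **Conjugate**: `conj A(½+it) = Σ ā_k k^{-1/2} e^{it log k}`. [folklore] -/
theorem conj_mollPoly (a : ℕ → ℂ) (N : ℕ) (t : ℝ) :
    conj (mollPoly a N t) =
      ∑ k ∈ Finset.Icc 1 N, conj (a k) * ((((k : ℝ) ^ (-(1 / 2 : ℝ)) : ℝ) : ℂ) * cexp (I * t * Real.log k)) := by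
  rw [mollPoly_eq_sum_exp, map_sum]
  refine Finset.sum_congr rfl fun k _ => ?_
  rw [map_mul, conj_term]

/-- `A(½+it)` is continuous in `t`. [folklore] -/
theorem continuous_mollPoly (a : ℕ → ℂ) (N : ℕ) : Continuous (mollPoly a N) := by
  have e : mollPoly a N = fun t : ℝ =>
      ∑ k ∈ Finset.Icc 1 N, a k * ((((k : ℝ) ^ (-(1 / 2 : ℝ)) : ℝ) : ℂ) * cexp (-(I * t * Real.log k))) :=
    funext (mollPoly_eq_sum_exp a N)
  rw [e]
  refine continuous_finsetSum _ fun k _ => continuous_const.mul (continuous_const.mul ?_)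
  exact Complex.continuous_exp.comp (((continuous_const.mul Complex.continuous_ofReal).mul
    continuous_const).neg)

/-- `‖A(½+it)‖ ≤ Σ |a_k| k^{-1/2}`. [folklore] -/
theorem norm_mollPoly_le (a : ℕ → ℂ) (N : ℕ) (t : ℝ) :
    ‖mollPoly a N t‖ ≤ ∑ k ∈ Finset.Icc 1 N, ‖a k‖ * (k : ℝ) ^ (-(1 / 2 : ℝ)) := by
  rw [mollPoly_eq_sum_exp]
  refine (norm_sum_le _ _).trans (Finset.sum_le_sum fun k hk => ?_)
  have hk0 : (0 : ℝ) ≤ (k : ℝ) ^ (-(1 / 2 : ℝ)) := Real.rpow_nonneg (Nat.cast_nonneg k) _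
  rw [norm_mul, norm_mul, Complex.norm_real, Real.norm_of_nonneg hk0,
    show I * (t : ℂ) * (Real.log k : ℂ) = ((t * Real.log k : ℝ) : ℂ) * I by push_cast; ring,
    ← neg_mul, show -(((t * Real.log k : ℝ)) : ℂ) = ((-(t * Real.log k) : ℝ) : ℂ) by push_cast; ring,
    Complex.norm_exp_ofReal_mul_I, mul_one]

/-- **`|A(½+it)|²` as a double sum**:
`|A(½+it)|² = Σ_{h,k ≤ N} a_h ā_k (hk)^{-1/2} e^{it(log k − log h)}` (as a complex number).
[cite: Titchmarsh1986, §7.4] -/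
theorem normSq_mollPoly_eq (a : ℕ → ℂ) (N : ℕ) (t : ℝ) :
    (((‖mollPoly a N t‖ ^ 2 : ℝ)) : ℂ) =
      ∑ h ∈ Finset.Icc 1 N, ∑ k ∈ Finset.Icc 1 N,
        a h * conj (a k) * ((((h : ℝ) * k) ^ (-(1 / 2 : ℝ)) : ℝ) : ℂ) *
          cexp (I * t * ((Real.log k - Real.log h : ℝ) : ℂ)) := by
  have e : (((‖mollPoly a N t‖ ^ 2 : ℝ)) : ℂ) = mollPoly a N t * conj (mollPoly a N t) := by
    rw [Complex.mul_conj, Complex.normSq_eq_norm_sq]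
  rw [e, conj_mollPoly, mollPoly_eq_sum_exp, Finset.sum_mul_sum]
  refine Finset.sum_congr rfl fun h _ => Finset.sum_congr rfl fun k _ => ?_
  rw [Real.mul_rpow (Nat.cast_nonneg h) (Nat.cast_nonneg k), Complex.ofReal_mul]
  have hexp : cexp (-(I * t * Real.log h)) * cexp (I * t * Real.log k) =
      cexp (I * t * ((Real.log k - Real.log h : ℝ) : ℂ)) := by
    rw [← Complex.exp_add]
    congr 1
    push_cast
    ring
  calc a h * ((((h : ℝ) ^ (-(1 / 2 : ℝ)) : ℝ) : ℂ) * cexp (-(I * t * Real.log h))) *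
        (conj (a k) * ((((k : ℝ) ^ (-(1 / 2 : ℝ)) : ℝ) : ℂ) * cexp (I * t * Real.log k)))
      = a h * conj (a k) * ((((h : ℝ) ^ (-(1 / 2 : ℝ)) : ℝ) : ℂ) * (((k : ℝ) ^ (-(1 / 2 : ℝ)) : ℝ) : ℂ)) *
          (cexp (-(I * t * Real.log h)) * cexp (I * t * Real.log k)) := by ring
    _ = _ := by rw [hexp]

/-- The approximate functional equation sum in the same exponent convention is `mainSum`:
`Σ_{n ≤ P} n^{-(½+it)} = S_P(t)`. [folklore] -/
theorem sum_cpow_eq_mainSum (P : ℕ) (t : ℝ) :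
    ∑ n ∈ Finset.Icc 1 P, (n : ℂ) ^ (-(((1 / 2 : ℝ) : ℂ) + t * I)) = mainSum P t := by
  rw [← afeSum_eq_mainSum]
  exact Finset.sum_congr rfl fun n _ => by rw [neg_half_add_eq]

/-- With `α ≡ 1`: `Σ_{n ≤ P} 1 · n^{-(½+it)} = S_P(t)` (the second factor of
`LevinsonMS.norm_weighted_meanSquare_mul_sub_diag_le` with `α = 1`, `a = ½`). [folklore] -/
theorem sum_one_mul_cpow_eq_mainSum (P : ℕ) (t : ℝ) :
    ∑ n ∈ Finset.Icc 1 P, (fun _ : ℕ => (1 : ℂ)) n * (n : ℂ) ^ (-(((1 / 2 : ℝ) : ℂ) + t * I)) =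
      mainSum P t := by
  rw [← sum_cpow_eq_mainSum]
  exact Finset.sum_congr rfl fun n _ => by simp

end Literature.NumberTheory.LFunctions.BCH
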